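import Literature.Barriers.QuantumAdvantage.Algebrization
import Literature.Computability.Complexity.AlgebrizationBarriersProofs
import Literature.Computability.Complexity.AlgebrizationBarriersBQPProofs
import HarnessLib

/-!
# Barrier `Algebrization` (`QuantumAdvantage` catalogue): the entry fact, discharged

Sibling proof file (D-0014 append protocol; theorems only) of the D-0021 barrier entry
`Literature/Barriers/QuantumAdvantage/Algebrization.lean`. The entry fact

`Algebrization :`
`  aaronsonWigderson2009_bqp_subset_bpp_collapse ∧ aaronsonWigderson2009_bqp_not_subset_bpp`

(Aaronson–Wigderson: `A, Ã` with `BQP^Ã ⊆ BPP^A`, the `BQP` instance of the Thm. 5.2 collapse;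
`A, Ã` with `BQP^A ⊄ BPP^Ã`, Thm. 5.11 (v); tree model: `BQPRel` = polynomial-time uniform
Clifford+T families with XOR-query gates to a language, `BPPRel` on G01 oracles, `Ã` the
multilinear extension) is the conjunction of two named facts of
`Computability/Complexity/AlgebrizationBarriers.lean`, and the entry stays light on imports. Both
facts are theorems of the tree: `aaronsonWigderson2009_bqp_subset_bpp_collapse_holds`
(`Computability/Complexity/AlgebrizationBarriersProofs.lean`: the autoreducible collapse oracle and
its multilinear extension) and `aaronsonWigderson2009_bqp_not_subset_bpp_holds`
(`Computability/Complexity/AlgebrizationBarriersBQPProofs.lean`, through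
`QuantumComplexity/OracleSeparationBQPBPPAlgebraic.lean`). This file records the unconditional
consequences: `Algebrization_holds` and the hypothesis-free forms of the entry's no-go readings
(`Algebrization.summary'`, `Algebrization.not_isAlgebrizingSeparation_bit'`,
`Algebrization.exists_collapse'`).

## References

* S. Aaronson, A. Wigderson, *Algebrization: a new barrier in complexity theory*, STOC 2008,
  full version [AaronsonWigderson2008]: Def. 2.1–2.3 (pp. 8–9), Thm. 5.2 (p. 23), Thm. 5.11 (v)
  (pp. 27–28), §1 (table, p. 7); journal version ACM TOCT 1 (2009) [AaronsonWigderson2009].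
* R. Impagliazzo, V. Kabanets, A. Kolokolova, *An axiomatic approach to algebrization*, STOC 2009
  [ImpagliazzoKabanetsKolokolova2009], §1.
-/

noncomputable section

namespace Literature.Barriers.QuantumAdvantage

open _root_.Computability Literature.Computability.Complexity Literature.Computability.Cryptography

/-- **The algebrization barrier for `BQP` versus `BPP`, unconditional**: there are `A, Ã` (`Ã` a
multilinear extension of `A`) with `BQP^Ã ⊆ BPP^A`, and `A, Ã` with `BQP^A ⊄ BPP^Ã` — the
catalogue fact `Algebrization` holds, both oracle facts being discharged in the tree.
[cite: AaronsonWigderson2008, Thm. 5.2 (collapse) and Thm. 5.11 (v) (separation)] -/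
theorem Algebrization_holds : Algebrization :=
  Algebrization.of_aw aaronsonWigderson2009_bqp_subset_bpp_collapse_holds
    aaronsonWigderson2009_bqp_not_subset_bpp_holds

/-- **Neither `BQP ⊄ BPP` nor `BQP ⊆ BPP` algebrizes, for any presentation of `BQP^·`**,
hypothesis-free form of the entry's `Algebrization.summary`: for every oracle-indexed class `C`
agreeing with `BQPRel` on language oracles and with `BQPRel ∘ bitLanguage` on extension oracles,
the separation from `BPPRel` (the summit's shape) is not algebrizing and the inclusion in
`BPPRel` (route `Dequantize`'s thesis shape) is not algebrizing.
[cite: AaronsonWigderson2008, §1 (table, p. 7) with Def. 2.3, Thm. 5.2 and Thm. 5.11 (v)] -/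
theorem Algebrization.summary' {C : Oracle → Set (Language Bool)}
    (hC : ∀ A : Language Bool, C (Oracle.ofLanguage A) = BQPRel A) (hCext : PresentsBQPRelExt C) :
    ¬ IsAlgebrizingSeparation C BPPRel ∧ ¬ IsAlgebrizingInclusion C BPPRel :=
  Algebrization_holds.summary hC hCext

/-- The separation no-go for the canonical presentation `O ↦ BQP^{bitLanguage O}` — no
hypothesis left at all. [cite: AaronsonWigderson2008, Thm. 5.2 with Def. 2.3] -/
theorem Algebrization.not_isAlgebrizingSeparation_bit' :
    ¬ IsAlgebrizingSeparation (fun O => BQPRel (Oracle.bitLanguage O)) BPPRel :=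
  Algebrization_holds.not_isAlgebrizingSeparation_bit

/-- The algebraic collapse oracle exists unconditionally: some `A` and extension oracle `Ã` with
`BQP^{bitLanguage Ã} ⊆ BPP^A`. [cite: AaronsonWigderson2008, Thm. 5.2] -/
theorem Algebrization.exists_collapse' :
    ∃ (A : Language Bool) (Ã : ExtensionOracle),
      BQPRel (Oracle.bitLanguage Ã.toOracle) ⊆ BPPRel (Oracle.ofLanguage A) :=
  Algebrization_holds.exists_collapse

end Literature.Barriers.QuantumAdvantage

end
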